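import Literature.NumberTheory.EllipticCurves.BSDAverageRankFiveSelmer
import Literature.NumberTheory.EllipticCurves.HeightDensityLemmas
import HarnessLib

/-!
# At least `83.75%` of elliptic curves over `ℚ` have rank `0` or `1`, and at least `20.62%` have
# rank `0`: Bhargava–Shankar's Theorems 4 and 5, reduced to their three inputs

Topic `Literature/NumberTheory/EllipticCurves`, family `bsd`. Sibling of
`BSDAverageRankFiveSelmer.lean` (which does the same for Theorem 3, the average rank `< .885`):

> M. Bhargava, A. Shankar, *The average size of the 5-Selmer group of elliptic curves is 6, and the
> average rank is less than 1*, arXiv:1312.7859 (2013), p. 2: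
> **Theorem 4.** "When elliptic curves over `ℚ` are ordered by height, a density of at least
> `83.75%` have rank `0` or `1`."
> **Theorem 5.** "When elliptic curves over `ℚ` are ordered by height, a density of at least
> `20.62%` have rank `0`."

The number `83.75% = .5501 × 7/8 + .4499 × 19/24` is the ceiling of every "proportion of curves
satisfying BSD" argument run on the `5`-Selmer average (Bhargava–Skinner–Zhang, arXiv:1407.1826,
Cor 26 and §4: a `p`-converse theorem can at best certify the curves of `5`-Selmer rank `≤ 1`, and
`19/24 + κ/12` is all the first moment gives); it is recorded here as a theorem of the tree modulo
exactly the three deep inputs of the printed proof, which are the SAME three hypotheses `h31`, `h6`,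
`hDD` as in `Literature.NumberTheory.EllipticCurves.averageRankLE_of_five_selmer_of_inputs`
(transcribed there from the printed Thm 31, Thm 6 with §5, and Thm 39; see that file's section
comment "The three inputs"). No new named fact is introduced (D-0026); nothing is restated.

## The printed proof (source §6, pp. 20–21)

* **Prop 38(b)** (any large family `F`, from Thm 31 alone): "Let `x_{0 or 1}` be the lower density
  of elliptic curves in `F` having `5`-Selmer rank `0` or `1`. Then … `x_{0 or 1} + 25(1 - x_{0 or 1})
  ≤ 6`, and hence `x_{0 or 1} ≥ 19/24`."
* **Prop 40(b), (c)** (a large family `F` in which exactly `50%` of the curves have root number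
  `+1`, from Thm 31 and Thm 39): "`x₀ + 25(1/2 - x₀) + 5(x₁ + 25(1/2 - x₁)) ≤ 6`. Thus
  `24x₀ + 120x₁ ≥ 69`. In conjunction with the constraint `x₁ ≤ 1/2`, it follows that
  `x_{0 or 1} ≥ x₀ + x₁ ≥ 7/8`, proving (b)"; "`x₀ + 25(1/2 - x₀) + 5/2 ≤ 6` … and thus `x₀ ≥ 3/8`,
  proving (c)."
* **Thms 4, 5**: "applying Proposition 40 on the family `F` constructed in Theorem 6, applying
  Proposition 38 on the complement of `F`, and noting that the `5`-Selmer rank of an elliptic curve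
  `E` is an upper bound for its rank `r(E)`. … the lower density of elliptic curves with rank `0` or
  `1` is at least `.5501 × 7/8 + .4499 × 19/24 ≥ .8375` … the lower density of elliptic curves with
  rank `0` is at least `.5501 × 3/8 ≥ .2062`."

## What is proved here, and how the bookkeeping is arranged

As in the sibling file, the linear programmes of Props 38/40 are run **pointwise** and on the
integer `m = s₅(E) - t₅(E)` (`#Sel^(5) = 5^{s₅}`, `#E(ℚ)[5] = 5^{t₅}`), which bounds the rank
(`5^{rank} · #E(ℚ)[5] ≤ #Sel^(5)`, the tree's proved descent inequality) and whose parity is the root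
number (Thm 39, `hDD`) — `exists_rank_le_of_parity` of the sibling file. This makes the source's tacit
"`E(ℚ)[5] = 0` for `100%` of curves" unnecessary: a curve with rational `5`-torsion simply has a
larger Selmer group.
* `twentyfour_mul_ite_two_le_rank_le`: **`24·[rank ≥ 2] ≤ #Sel^(5) - 1`** for every `E/ℚ` (Prop 38(b)
  pointwise: `rank ≥ 2 ⇒ #Sel^(5) ≥ 25`; no parity).
* `twentyfour_mul_ite_two_le_rank_le_of_parity`: **`24·[rank ≥ 2] ≤ #Sel^(5) - 3 + 2·w(E)`** (Prop
  40(b) pointwise: for `w = +1`, `m` is even, so `m ≥ 2` as soon as `rank ≥ 2`, and `#Sel^(5) - 1 ≥ 24`;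
  for `w = -1`, `m` is odd, so `#Sel^(5) ≥ 5` always and `≥ 125` when `rank ≥ 2`). Averaged over a
  family with `∑ w = 0` and average `#Sel^(5) ≤ 6` this is exactly "`x₀ + x₁ ≥ 7/8`"; the dual
  multipliers `(3, -2, 24)` are read off from the source's extremal configuration
  `(37.5%, 50%, 12.5%)` at `5`-Selmer ranks `(0, 1, 2)`, where all three cases are equalities.
* `le_twentyfour_mul_ite_rank_eq_zero_of_parity`: **`15 - #Sel^(5) + 10·w(E) ≤ 24·[rank = 0]`** (Prop
  40(c) pointwise: `m = 0` forces `rank = 0`; `m ≥ 2` even forces `#Sel^(5) ≥ 25`; `m` odd forces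
  `#Sel^(5) ≥ 5`), i.e. "`x₀ ≥ 3/8`" with multipliers `(15, 10, 24)`.
* `card_two_le_rank_le`, `le_card_rank_eq_zero`: the finite-height bookkeeping — for `U` stable under
  `E ↦ E₋₁ = E_{A,-B}` with `w(E₋₁) = -w(E)` (so `∑_U w = 0`, `sum_rootNumber_eq_zero`):
  `24·#{H < X : rank ≥ 2} ≤ ∑_{all} #Sel^(5) - #{all} - 2·#{U}` and
  `15·#{U} - ∑_U #Sel^(5) ≤ 24·#{H < X : rank = 0}`.
* `heightDensityGE_rankLeOne_of_five_selmer_family` / `heightDensityGE_rankZero_of_five_selmer_family`: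
  with Thm 31 (`h31`) on the family of all curves (`CongruenceFamily.isLarge_allCurves`) resp. on the
  pieces of `U`, and `U` of lower density `κ`, the lower densities are `≥ 19/24 + κ/12` (rank `≤ 1`)
  and `≥ 3κ/8` (rank `0`) — the source's `κ·7/8 + (1-κ)·19/24` and `κ·3/8` for general `κ`.
* `heightDensityGE_rankLeOne_of_five_selmer_of_inputs` (**Thm 4**, `0.8375`) and
  `heightDensityGE_rankZero_of_five_selmer_of_inputs` (**Thm 5**, `0.2062`): the case `κ = .5501`
  of Thm 6, with LITERALLY the hypotheses `h31`, `h6`, `hDD` of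
  `averageRankLE_of_five_selmer_of_inputs`; `pos_proportion_rank_zero_of_five_selmer_inputs`: hence the
  named fact `Literature.NumberTheory.EllipticCurves.pos_proportion_rank_zero` of `BSDWave0.lean` (a second
  conditional route to it, next to the ternary-cubic one of `BSDRankZeroAssembly.lean`).
* `heightDensityGE_rankLeOne_nineteen_24ths_of_heightAverageLE_card_selmerFive` (Prop 38(b) for the
  family of all curves): **granted Theorem 1 alone** (`HeightAverageLE (#Sel^(5)) 6`, no root numbers,
  no parity, no large families) at least `19/24 = 79.16%` of curves have rank `0` or `1`.

## Remarks on faithfulness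

Those of the sibling file apply verbatim (`h31` is weaker than the printed Thm 31; `h6` transcribes
Thm 6 with §5 as an existence statement with lower density `≥ .5501`; Thm 39 is the tree's
`even_selmerRank_sub_torsionRank_iff`). The conclusions are lower densities in `liminf` form
(`HeightDensityGE`), as printed ("a density of at least"); the source's third sentence after Thm 5
("if Ш is finite … at least `26.12%` have rank `1`") is not recorded.

## References

* [BhargavaShankar5Selmer2013] M. Bhargava, A. Shankar, arXiv:1312.7859: Thms 4, 5 (p. 2), Thms 6,
  31, 39, Props 38(b), 40(b)(c) and the last paragraph of §6 (pp. 20–21).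
* [BhargavaSkinnerZhang2014] M. Bhargava, C. Skinner, W. Zhang, arXiv:1407.1826, Thm 25 and §4
  (the same linear programme; `83.75%` as the limit of the method).
* [DokchitserDokchitserAnnals2010] T. Dokchitser, V. Dokchitser, Ann. of Math. 172 (2010), Thm 1.4.
* [SilvermanAEC2009] J. H. Silverman, *The Arithmetic of Elliptic Curves*, 2nd ed., Thm X.4.2.
-/

noncomputable section

open scoped Classical
open Filter Topology WeierstrassCurve

namespace Literature.NumberTheory.EllipticCurves

/-! ### The linear programmes of Props 38(b), 40(b), 40(c), pointwise -/

section PerCurve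

variable (W : WeierstrassCurve ℚ) [W.IsElliptic]

/-- **Prop 38(b) pointwise, unconditionally**: for every elliptic curve `E/ℚ`,
`24·[rank E(ℚ) ≥ 2] ≤ #Sel^(5)(E/ℚ) - 1` (if `rank ≥ 2` then `25 ≤ 5^rank ≤ #Sel^(5)`; in any case
`1 ≤ #Sel^(5)`). Only the descent inequality `5^rank ≤ #Sel^(5)`
(`WeierstrassCurve.pow_rank_le_card_selmerGroup`, proved in the tree) is used.
[cite: BhargavaShankar5Selmer2013, Prop 38(b) (proof: "x + 25(1 - x) ≤ 6")] -/
theorem twentyfour_mul_ite_two_le_rank_le :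
    24 * (if 2 ≤ W.mordellWeilRank then (1 : ℝ) else 0) ≤ (Nat.card (W.selmerGroup 5) : ℝ) - 1 := by
  have hpow := W.pow_rank_le_card_selmerGroup (by norm_num : (5 : ℕ) ≠ 0)
  have hpowR : ((5 : ℕ) ^ W.mordellWeilRank : ℝ) ≤ (Nat.card (W.selmerGroup 5) : ℝ) := by
    exact_mod_cast hpow
  push_cast at hpowR
  split_ifs with h2
  · have h25 : (5 : ℝ) ^ 2 ≤ (5 : ℝ) ^ W.mordellWeilRank :=
      pow_le_pow_right₀ (by norm_num : (1 : ℝ) ≤ 5) h2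
    norm_num at h25
    linarith
  · have h1 : (1 : ℝ) ≤ (5 : ℝ) ^ W.mordellWeilRank := one_le_pow₀ (by norm_num)
    linarith

/-- **Prop 40(b) pointwise** (with Thm 39 of the source, hypothesis `hDD`): for every elliptic curve
`E/ℚ`, `24·[rank E(ℚ) ≥ 2] ≤ #Sel^(5)(E/ℚ) - 3 + 2·w(E)`, i.e. `≤ #Sel^(5) - 1` if `w(E) = +1` and
`≤ #Sel^(5) - 5` if `w(E) = -1`. With `m = s₅ - t₅ ≥ rank`, `5^m ≤ #Sel^(5)`, `m` even iff `w = +1`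
(`exists_rank_le_of_parity`): for `w = +1` and `rank ≥ 2`, `m ≥ 2` and `#Sel^(5) ≥ 25`; for `w = -1`,
`m` is odd, so `#Sel^(5) ≥ 5`, and `≥ 125` if `rank ≥ 2`. (Summed over a family with `∑ w = 0` and
average `#Sel^(5) ≤ 6` this is the source's "`24x₀ + 120x₁ ≥ 69` … `x₀ + x₁ ≥ 7/8`".)
[cite: BhargavaShankar5Selmer2013, Prop 40(b) (proof) and Thm 39] -/
theorem twentyfour_mul_ite_two_le_rank_le_of_parity (hDD : even_selmerRank_sub_torsionRank_iff) :
    24 * (if 2 ≤ W.mordellWeilRank then (1 : ℝ) else 0) ≤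
      (Nat.card (W.selmerGroup 5) : ℝ) - 3 + 2 * (W.rootNumber : ℝ) := by
  haveI : Fact (Nat.Prime 5) := ⟨by norm_num⟩
  obtain ⟨m, hrm, hpow, hpar⟩ := exists_rank_le_of_parity W 5 hDD
  have hpowR : ((5 : ℕ) ^ m : ℝ) ≤ (Nat.card (W.selmerGroup 5) : ℝ) := by exact_mod_cast hpow
  push_cast at hpowR
  rcases W.rootNumber_eq_one_or with hw | hw
  · rw [hw]
    push_cast
    split_ifs with h2
    · have h25 : (5 : ℝ) ^ 2 ≤ (5 : ℝ) ^ m :=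
        pow_le_pow_right₀ (by norm_num : (1 : ℝ) ≤ 5) (h2.trans hrm)
      norm_num at h25
      linarith
    · have h1 : (1 : ℝ) ≤ (5 : ℝ) ^ m := one_le_pow₀ (by norm_num)
      linarith
  · have hodd : Odd m := by
      rcases Nat.even_or_odd m with h | h
      · exact absurd (hpar.mp h) (by rw [hw]; norm_num)
      · exact h
    rw [hw]
    push_cast
    split_ifs with h2
    · have hm3 : 3 ≤ m := by
        obtain ⟨k, hk⟩ := hodd
        omega
      have h125 : (5 : ℝ) ^ 3 ≤ (5 : ℝ) ^ m :=
        pow_le_pow_right₀ (by norm_num : (1 : ℝ) ≤ 5) hm3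
      norm_num at h125
      linarith
    · have hm1 : 1 ≤ m := by
        obtain ⟨k, hk⟩ := hodd
        omega
      have h5 : (5 : ℝ) ^ 1 ≤ (5 : ℝ) ^ m :=
        pow_le_pow_right₀ (by norm_num : (1 : ℝ) ≤ 5) hm1
      norm_num at h5
      linarith

/-- **Prop 40(c) pointwise** (with Thm 39, `hDD`): for every elliptic curve `E/ℚ`,
`15 - #Sel^(5)(E/ℚ) + 10·w(E) ≤ 24·[rank E(ℚ) = 0]`. With `m = s₅ - t₅` as above: if `w = +1` then
`m` is even, and either `m = 0` (then `rank = 0` and `#Sel^(5) ≥ 1`) or `m ≥ 2` (then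
`#Sel^(5) ≥ 25`); if `w = -1` then `m` is odd and `#Sel^(5) ≥ 5`. (Summed over a family with
`∑ w = 0` and average `#Sel^(5) ≤ 6`: "`x₀ + 25(1/2 - x₀) + 5/2 ≤ 6` … thus `x₀ ≥ 3/8`".)
[cite: BhargavaShankar5Selmer2013, Prop 40(c) (proof) and Thm 39] -/
theorem le_twentyfour_mul_ite_rank_eq_zero_of_parity (hDD : even_selmerRank_sub_torsionRank_iff) :
    15 - (Nat.card (W.selmerGroup 5) : ℝ) + 10 * (W.rootNumber : ℝ) ≤
      24 * (if W.mordellWeilRank = 0 then (1 : ℝ) else 0) := by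
  haveI : Fact (Nat.Prime 5) := ⟨by norm_num⟩
  obtain ⟨m, hrm, hpow, hpar⟩ := exists_rank_le_of_parity W 5 hDD
  have hpowR : ((5 : ℕ) ^ m : ℝ) ≤ (Nat.card (W.selmerGroup 5) : ℝ) := by exact_mod_cast hpow
  push_cast at hpowR
  have hind : (0 : ℝ) ≤ (if W.mordellWeilRank = 0 then (1 : ℝ) else 0) := by
    split_ifs <;> norm_num
  rcases W.rootNumber_eq_one_or with hw | hw
  · rw [hw]
    push_cast
    rcases Nat.eq_zero_or_pos m with hm0 | hmpos
    · have hr : W.mordellWeilRank = 0 := by omega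
      rw [if_pos hr]
      have h1 : (1 : ℝ) ≤ (5 : ℝ) ^ m := one_le_pow₀ (by norm_num)
      linarith
    · have hm2 : 2 ≤ m := by
        obtain ⟨k, hk⟩ := hpar.mpr hw
        omega
      have h25 : (5 : ℝ) ^ 2 ≤ (5 : ℝ) ^ m :=
        pow_le_pow_right₀ (by norm_num : (1 : ℝ) ≤ 5) hm2
      norm_num at h25
      linarith
  · have hm1 : 1 ≤ m := by
      rcases Nat.even_or_odd m with h | h
      · exact absurd (hpar.mp h) (by rw [hw]; norm_num)
      · obtain ⟨k, hk⟩ := h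
        omega
    rw [hw]
    push_cast
    have h5 : (5 : ℝ) ^ 1 ≤ (5 : ℝ) ^ m :=
      pow_le_pow_right₀ (by norm_num : (1 : ℝ) ≤ 5) hm1
    norm_num at h5
    linarith

end PerCurve

/-! ### The bookkeeping of §6 at a finite height -/

section Reduction

/-- **The count behind Thm 4 at a finite height `X`.** Let `U` be stable under `E ↦ E₋₁ = E_{A,-B}`
with `w(E₋₁) = -w(E)` on `U` (so `∑_U w = 0`, `sum_rootNumber_eq_zero`), and grant Thm 39 (`hDD`).
Summing `24·[rank ≥ 2] ≤ #Sel^(5) - 3 + 2w` (`twentyfour_mul_ite_two_le_rank_le_of_parity`) over the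
members of `U` of height `< X` and `24·[rank ≥ 2] ≤ #Sel^(5) - 1` (`twentyfour_mul_ite_two_le_rank_le`)
over the other curves of height `< X` gives
`24·#{H < X : rank ≥ 2} ≤ ∑_{H < X} #Sel^(5) - #{H < X} - 2·#{U, H < X}`
(Prop 40(b) on `U`, Prop 38(b) on its complement, before dividing by the number of curves).
[cite: BhargavaShankar5Selmer2013, §6 (proof of Thm 4: Props 38(b), 40(b))] -/
theorem card_two_le_rank_le (hDD : even_selmerRank_sub_torsionRank_iff) (U : ℤ × ℤ → Prop)
    (hU : ∀ AB, U AB → U (negB AB))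
    (hflip : ∀ AB, U AB →
      (shortWeierstrass (negB AB)).rootNumber = -(shortWeierstrass AB).rootNumber) (X : ℕ) :
    24 * (((heightFamilyBelow X).filter
        (fun AB ↦ 2 ≤ (shortWeierstrass AB).mordellWeilRank)).card : ℝ) ≤
      ∑ AB ∈ heightFamilyBelow X, (Nat.card ((shortWeierstrass AB).selmerGroup 5) : ℝ) -
        (heightFamilyBelow X).card - 2 * ((heightFamilyBelow X).filter U).card := by
  -- members of the height family are elliptic curves
  have hell : ∀ AB ∈ heightFamilyBelow X, (shortWeierstrass AB).IsElliptic :=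
    fun AB hAB ↦ isElliptic_shortWeierstrass ((mem_heightFamilyBelow_iff AB X).mp hAB).1
  rw [Finset.natCast_card_filter]
  -- split the indicator sum, the Selmer sum and the count according to `U`
  have hsplitI := Finset.sum_filter_add_sum_filter_not (heightFamilyBelow X) U
    (fun AB ↦ (if 2 ≤ (shortWeierstrass AB).mordellWeilRank then (1 : ℝ) else 0))
  have hsplitS := Finset.sum_filter_add_sum_filter_not (heightFamilyBelow X) U
    (fun AB ↦ (Nat.card ((shortWeierstrass AB).selmerGroup 5) : ℝ))
  have hcards := Finset.card_filter_add_card_filter_not (s := heightFamilyBelow X) U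
  have hcards' : (((heightFamilyBelow X).filter U).card : ℝ) +
      ((heightFamilyBelow X).filter (fun AB ↦ ¬ U AB)).card = (heightFamilyBelow X).card := by
    exact_mod_cast hcards
  -- on `U`: `24·[rank ≥ 2] ≤ #Sel - 3 + 2 w`, and `∑ w = 0`
  have hUsum : 24 * ∑ AB ∈ (heightFamilyBelow X).filter U,
      (if 2 ≤ (shortWeierstrass AB).mordellWeilRank then (1 : ℝ) else 0) ≤
      ∑ AB ∈ (heightFamilyBelow X).filter U,
          (Nat.card ((shortWeierstrass AB).selmerGroup 5) : ℝ) -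
        3 * ((heightFamilyBelow X).filter U).card := by
    have h := Finset.sum_le_sum (s := (heightFamilyBelow X).filter U)
      (f := fun AB ↦ 24 * (if 2 ≤ (shortWeierstrass AB).mordellWeilRank then (1 : ℝ) else 0))
      (g := fun AB ↦ (Nat.card ((shortWeierstrass AB).selmerGroup 5) : ℝ) - 3 +
        2 * ((shortWeierstrass AB).rootNumber : ℝ)) fun AB hAB ↦ by
        haveI := hell AB (Finset.mem_filter.mp hAB).1
        exact twentyfour_mul_ite_two_le_rank_le_of_parity (shortWeierstrass AB) hDD
    rw [← Finset.mul_sum, Finset.sum_add_distrib, Finset.sum_sub_distrib, ← Finset.mul_sum,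
      sum_rootNumber_eq_zero U hU hflip X, Finset.sum_const, nsmul_eq_mul] at h
    linarith
  -- off `U`: `24·[rank ≥ 2] ≤ #Sel - 1`
  have hCsum : 24 * ∑ AB ∈ (heightFamilyBelow X).filter (fun AB ↦ ¬ U AB),
      (if 2 ≤ (shortWeierstrass AB).mordellWeilRank then (1 : ℝ) else 0) ≤
      ∑ AB ∈ (heightFamilyBelow X).filter (fun AB ↦ ¬ U AB),
          (Nat.card ((shortWeierstrass AB).selmerGroup 5) : ℝ) -
        ((heightFamilyBelow X).filter (fun AB ↦ ¬ U AB)).card := by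
    have h := Finset.sum_le_sum (s := (heightFamilyBelow X).filter (fun AB ↦ ¬ U AB))
      (f := fun AB ↦ 24 * (if 2 ≤ (shortWeierstrass AB).mordellWeilRank then (1 : ℝ) else 0))
      (g := fun AB ↦ (Nat.card ((shortWeierstrass AB).selmerGroup 5) : ℝ) - 1) fun AB hAB ↦ by
        haveI := hell AB (Finset.mem_filter.mp hAB).1
        exact twentyfour_mul_ite_two_le_rank_le (shortWeierstrass AB)
    rw [← Finset.mul_sum, Finset.sum_sub_distrib, Finset.sum_const, nsmul_eq_mul] at h
    linarith
  linarith [hUsum, hCsum, hsplitI, hsplitS, hcards']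

/-- **The count behind Thm 5 at a finite height `X`.** For `U` stable under `E ↦ E₋₁` with
`w(E₋₁) = -w(E)` on `U`, granted Thm 39 (`hDD`): summing `15 - #Sel^(5) + 10w ≤ 24·[rank = 0]`
(`le_twentyfour_mul_ite_rank_eq_zero_of_parity`) over the members of `U` of height `< X` (`∑_U w = 0`)
gives `15·#{U, H < X} - ∑_{U, H < X} #Sel^(5) ≤ 24·#{U, H < X : rank = 0} ≤ 24·#{H < X : rank = 0}`
(Prop 40(c) on `U`, before dividing by the number of curves).
[cite: BhargavaShankar5Selmer2013, §6 (proof of Thm 5: Prop 40(c))] -/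
theorem le_card_rank_eq_zero (hDD : even_selmerRank_sub_torsionRank_iff) (U : ℤ × ℤ → Prop)
    (hU : ∀ AB, U AB → U (negB AB))
    (hflip : ∀ AB, U AB →
      (shortWeierstrass (negB AB)).rootNumber = -(shortWeierstrass AB).rootNumber) (X : ℕ) :
    15 * (((heightFamilyBelow X).filter U).card : ℝ) -
        ∑ AB ∈ (heightFamilyBelow X).filter U,
          (Nat.card ((shortWeierstrass AB).selmerGroup 5) : ℝ) ≤
      24 * (((heightFamilyBelow X).filter
        (fun AB ↦ (shortWeierstrass AB).mordellWeilRank = 0)).card : ℝ) := by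
  have hell : ∀ AB ∈ heightFamilyBelow X, (shortWeierstrass AB).IsElliptic :=
    fun AB hAB ↦ isElliptic_shortWeierstrass ((mem_heightFamilyBelow_iff AB X).mp hAB).1
  rw [Finset.natCast_card_filter (fun AB ↦ (shortWeierstrass AB).mordellWeilRank = 0)]
  -- on `U`: `15 - #Sel + 10 w ≤ 24·[rank = 0]`, and `∑ w = 0`
  have hUsum : ∑ AB ∈ (heightFamilyBelow X).filter U,
      (15 - (Nat.card ((shortWeierstrass AB).selmerGroup 5) : ℝ) +
        10 * ((shortWeierstrass AB).rootNumber : ℝ)) ≤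
      24 * ∑ AB ∈ (heightFamilyBelow X).filter U,
        (if (shortWeierstrass AB).mordellWeilRank = 0 then (1 : ℝ) else 0) := by
    have h := Finset.sum_le_sum (s := (heightFamilyBelow X).filter U)
      (f := fun AB ↦ 15 - (Nat.card ((shortWeierstrass AB).selmerGroup 5) : ℝ) +
        10 * ((shortWeierstrass AB).rootNumber : ℝ))
      (g := fun AB ↦ 24 * (if (shortWeierstrass AB).mordellWeilRank = 0 then (1 : ℝ) else 0))
      fun AB hAB ↦ by
        haveI := hell AB (Finset.mem_filter.mp hAB).1
        exact le_twentyfour_mul_ite_rank_eq_zero_of_parity (shortWeierstrass AB) hDD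
    rwa [← Finset.mul_sum] at h
  have hLHS : ∑ AB ∈ (heightFamilyBelow X).filter U,
      (15 - (Nat.card ((shortWeierstrass AB).selmerGroup 5) : ℝ) +
        10 * ((shortWeierstrass AB).rootNumber : ℝ)) =
      15 * (((heightFamilyBelow X).filter U).card : ℝ) -
        ∑ AB ∈ (heightFamilyBelow X).filter U,
          (Nat.card ((shortWeierstrass AB).selmerGroup 5) : ℝ) := by
    rw [Finset.sum_add_distrib, Finset.sum_sub_distrib, ← Finset.mul_sum,
      sum_rootNumber_eq_zero U hU hflip X, Finset.sum_const, nsmul_eq_mul]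
    ring
  -- the members of `U` of rank `0` are among all curves of rank `0`
  have hmono : ∑ AB ∈ (heightFamilyBelow X).filter U,
      (if (shortWeierstrass AB).mordellWeilRank = 0 then (1 : ℝ) else 0) ≤
      ∑ AB ∈ heightFamilyBelow X,
        (if (shortWeierstrass AB).mordellWeilRank = 0 then (1 : ℝ) else 0) :=
    Finset.sum_le_sum_of_subset_of_nonneg (Finset.filter_subset _ _)
      fun _ _ _ ↦ by split_ifs <;> norm_num
  linarith

/-- **Thm 4 for a general root-number family.** If (`h31`, Thm 31) the average of `#Sel^(5)` over
every large congruence family is eventually `≤ 6 + ε`, if there is a finite disjoint union `U` of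
large congruence families of lower density `≥ κ`, stable under `E ↦ E₋₁ = E_{A,-B}` with
`w(E₋₁) = -w(E)`, and if (`hDD`, Thm 39) Dokchitser–Dokchitser parity holds, then at least a
proportion `7κ/8 + 19(1-κ)/24 = 19/24 + κ/12` of elliptic curves over `ℚ`, ordered by naive height,
have Mordell–Weil rank `≤ 1` (`liminf` form, `HeightDensityGE`). Proof: `card_two_le_rank_le` with
`∑_{all} #Sel^(5) ≤ (6 + η)·#{all}` (Thm 31 on the large family of all curves,
`CongruenceFamily.isLarge_allCurves`) and `#{U} ≥ (κ - η)·#{all}`.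
[cite: BhargavaShankar5Selmer2013, §6 (proof of Thm 4) with Props 38(b), 40(b)] -/
theorem heightDensityGE_rankLeOne_of_five_selmer_family {κ : ℝ}
    (h31 : ∀ F : CongruenceFamily, F.IsLarge → ∀ ε : ℝ, 0 < ε → ∀ᶠ X : ℕ in atTop,
      heightAverageOn F.Mem (fun AB ↦ (Nat.card ((shortWeierstrass AB).selmerGroup 5) : ℝ)) X ≤
        6 + ε)
    (hF : ∃ (n : ℕ) (F : Fin n → CongruenceFamily), (∀ i, (F i).IsLarge) ∧
      (∀ i j, i ≠ j → ∀ AB, (F i).Mem AB → ¬ (F j).Mem AB) ∧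
      (∀ AB, UnionMem F AB → UnionMem F (AB.1, -AB.2)) ∧
      (∀ AB, UnionMem F AB →
        (shortWeierstrass (AB.1, -AB.2)).rootNumber = -(shortWeierstrass AB).rootNumber) ∧
      HeightDensityGE (UnionMem F) κ)
    (hDD : even_selmerRank_sub_torsionRank_iff) :
    HeightDensityGE (fun AB ↦ (shortWeierstrass AB).mordellWeilRank ≤ 1) (19 / 24 + κ / 12) := by
  obtain ⟨n, F, -, -, htwist, hflip, hdens⟩ := hF
  intro ε hε
  -- Thm 31 on the family of all curves, with slack `8 ε`
  have e2 := eventually_sum_le_of_heightAverageOn_le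
    (fun _ : Fin 1 ↦ (CongruenceFamily.mk (fun _ ↦ 0) (fun _ ↦ Set.univ) True True).Mem)
    (fun i j hij _ _ ↦ (hij (Subsingleton.elim i j)).elim) IsInHeightFamily
    (fun AB ↦ ⟨fun h ↦ ⟨0, (CongruenceFamily.mem_allCurves_iff AB).mpr h⟩,
      fun ⟨_, h⟩ ↦ (CongruenceFamily.mem_allCurves_iff AB).mp h⟩)
    (fun AB ↦ (Nat.card ((shortWeierstrass AB).selmerGroup 5) : ℝ))
    (fun _ ↦ h31 _ CongruenceFamily.isLarge_allCurves (8 * ε) (by positivity))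
  -- the density of `U`, with slack `8 ε`
  have e3 := hdens (8 * ε) (by positivity)
  filter_upwards [e2, e3, eventually_ge_atTop 28] with X hX2 hX3 hX28
  have hfilt : (heightFamilyBelow X).filter IsInHeightFamily = heightFamilyBelow X :=
    Finset.filter_true_of_mem fun AB hAB ↦ ((mem_heightFamilyBelow_iff AB X).mp hAB).1
  rw [hfilt] at hX2
  have hpos : 0 < (heightFamilyBelow X).card :=
    Finset.card_pos.mpr ⟨_, zeroOne_mem_heightFamilyBelow hX28⟩
  have hN : (0 : ℝ) < (heightFamilyBelow X).card := by exact_mod_cast hpos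
  rw [heightProportion_eq_card_div, le_div_iff₀ hN] at hX3
  rw [heightProportion_eq_card_div, le_div_iff₀ hN]
  -- the count, and the complement `#{rank ≤ 1} + #{rank ≥ 2} = #{all}`
  have hcount := card_two_le_rank_le hDD (UnionMem F) (fun AB h ↦ htwist AB h)
    (fun AB h ↦ hflip AB h) X
  have hcompl : (((heightFamilyBelow X).filter
        (fun AB ↦ (shortWeierstrass AB).mordellWeilRank ≤ 1)).card : ℝ) +
      ((heightFamilyBelow X).filter (fun AB ↦ 2 ≤ (shortWeierstrass AB).mordellWeilRank)).card =
      (heightFamilyBelow X).card := by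
    have h := Finset.card_filter_add_card_filter_not (s := heightFamilyBelow X)
      (fun AB ↦ (shortWeierstrass AB).mordellWeilRank ≤ 1)
    have hcongr : (heightFamilyBelow X).filter
          (fun AB ↦ ¬ (shortWeierstrass AB).mordellWeilRank ≤ 1) =
        (heightFamilyBelow X).filter (fun AB ↦ 2 ≤ (shortWeierstrass AB).mordellWeilRank) :=
      Finset.filter_congr fun AB _ ↦ ⟨fun h' ↦ by omega, fun h' ↦ by omega⟩
    rw [hcongr] at h
    exact_mod_cast h
  linarith [hcount, hcompl, hX2, hX3]

/-- **Thm 5 for a general root-number family.** Under the same three inputs as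
`heightDensityGE_rankLeOne_of_five_selmer_family`, at least a proportion `3κ/8` of elliptic curves
over `ℚ`, ordered by naive height, have Mordell–Weil rank `0`. Proof: `le_card_rank_eq_zero` with
`∑_U #Sel^(5) ≤ (6 + η)·#{U}` (Thm 31 on the pieces of `U`, `eventually_sum_le_of_heightAverageOn_le`)
and `(κ - η)·#{all} ≤ #{U} ≤ #{all}`.
[cite: BhargavaShankar5Selmer2013, §6 (proof of Thm 5) with Prop 40(c)] -/
theorem heightDensityGE_rankZero_of_five_selmer_family {κ : ℝ}
    (h31 : ∀ F : CongruenceFamily, F.IsLarge → ∀ ε : ℝ, 0 < ε → ∀ᶠ X : ℕ in atTop,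
      heightAverageOn F.Mem (fun AB ↦ (Nat.card ((shortWeierstrass AB).selmerGroup 5) : ℝ)) X ≤
        6 + ε)
    (hF : ∃ (n : ℕ) (F : Fin n → CongruenceFamily), (∀ i, (F i).IsLarge) ∧
      (∀ i j, i ≠ j → ∀ AB, (F i).Mem AB → ¬ (F j).Mem AB) ∧
      (∀ AB, UnionMem F AB → UnionMem F (AB.1, -AB.2)) ∧
      (∀ AB, UnionMem F AB →
        (shortWeierstrass (AB.1, -AB.2)).rootNumber = -(shortWeierstrass AB).rootNumber) ∧
      HeightDensityGE (UnionMem F) κ)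
    (hDD : even_selmerRank_sub_torsionRank_iff) :
    HeightDensityGE (fun AB ↦ (shortWeierstrass AB).mordellWeilRank = 0) (3 * κ / 8) := by
  obtain ⟨n, F, hlarge, hdisj, htwist, hflip, hdens⟩ := hF
  intro ε hε
  -- Thm 31 on each (disjoint) piece of `U`, summed, with slack `6 ε`
  have e1 := eventually_sum_le_of_heightAverageOn_le (fun i ↦ (F i).Mem) hdisj (UnionMem F)
    (fun _ ↦ Iff.rfl) (fun AB ↦ (Nat.card ((shortWeierstrass AB).selmerGroup 5) : ℝ))
    (fun i ↦ h31 (F i) (hlarge i) (6 * ε) (by positivity))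
  -- the density of `U`, with slack `2 ε`
  have e3 := hdens (2 * ε) (by positivity)
  filter_upwards [e1, e3, eventually_ge_atTop 28] with X hX1 hX3 hX28
  have hpos : 0 < (heightFamilyBelow X).card :=
    Finset.card_pos.mpr ⟨_, zeroOne_mem_heightFamilyBelow hX28⟩
  have hN : (0 : ℝ) < (heightFamilyBelow X).card := by exact_mod_cast hpos
  rw [heightProportion_eq_card_div, le_div_iff₀ hN] at hX3
  rw [heightProportion_eq_card_div, le_div_iff₀ hN]
  have hcount := le_card_rank_eq_zero hDD (UnionMem F) (fun AB h ↦ htwist AB h)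
    (fun AB h ↦ hflip AB h) X
  -- `#{U} ≤ #{all}`, hence `ε·#{U} ≤ ε·#{all}`
  have hUle : (((heightFamilyBelow X).filter (UnionMem F)).card : ℝ) ≤ (heightFamilyBelow X).card := by
    exact_mod_cast Finset.card_le_card (Finset.filter_subset _ _)
  have hεU : ε * (((heightFamilyBelow X).filter (UnionMem F)).card : ℝ) ≤
      ε * (heightFamilyBelow X).card := mul_le_mul_of_nonneg_left hUle hε.le
  linarith [hcount, hX1, hX3, hεU]

/-- **Theorem 4 of the source from its three inputs.** If (`h31`, Thm 31) the average of `#Sel^(5)`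
over every large congruence family is eventually `≤ 6 + ε`, (`h6`, Thm 6 with §5) there is a finite
disjoint union `U` of large congruence families of lower density `≥ .5501`, stable under
`E ↦ E₋₁ = E_{A,-B}` with `w(E₋₁) = -w(E)`, and (`hDD`, Thm 39) the parity theorem of
Dokchitser–Dokchitser holds in the `p`-Selmer form `even_selmerRank_sub_torsionRank_iff` — the SAME
three hypotheses as `averageRankLE_of_five_selmer_of_inputs` — then, when elliptic curves over `ℚ`
are ordered by naive height, **a (lower) density of at least `83.75%` have Mordell–Weil rank `0` or
`1`**: "`.5501 × 7/8 + .4499 × 19/24 ≥ .8375`" (`19/24 + .5501/12 = .837508…`).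
[cite: BhargavaShankar5Selmer2013, Thm 4 and §6 (with Thm 31, Thm 6, Thm 39, Props 38(b), 40(b))] -/
theorem heightDensityGE_rankLeOne_of_five_selmer_of_inputs
    (h31 : ∀ F : CongruenceFamily, F.IsLarge → ∀ ε : ℝ, 0 < ε → ∀ᶠ X : ℕ in atTop,
      heightAverageOn F.Mem (fun AB ↦ (Nat.card ((shortWeierstrass AB).selmerGroup 5) : ℝ)) X ≤
        6 + ε)
    (h6 : ∃ (n : ℕ) (F : Fin n → CongruenceFamily), (∀ i, (F i).IsLarge) ∧
      (∀ i j, i ≠ j → ∀ AB, (F i).Mem AB → ¬ (F j).Mem AB) ∧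
      (∀ AB, UnionMem F AB → UnionMem F (AB.1, -AB.2)) ∧
      (∀ AB, UnionMem F AB →
        (shortWeierstrass (AB.1, -AB.2)).rootNumber = -(shortWeierstrass AB).rootNumber) ∧
      HeightDensityGE (UnionMem F) 0.5501)
    (hDD : even_selmerRank_sub_torsionRank_iff) :
    HeightDensityGE (fun AB ↦ (shortWeierstrass AB).mordellWeilRank ≤ 1) 0.8375 := by
  have h := heightDensityGE_rankLeOne_of_five_selmer_family h31 h6 hDD
  intro ε hε
  filter_upwards [h ε hε] with X hX
  norm_num at hX ⊢
  linarith

/-- **Theorem 5 of the source from its three inputs** (the same `h31`, `h6`, `hDD`): when elliptic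
curves over `ℚ` are ordered by naive height, **a (lower) density of at least `20.62%` have
Mordell–Weil rank `0`**: "`.5501 × 3/8 ≥ .2062`" (`= .2062875`).
[cite: BhargavaShankar5Selmer2013, Thm 5 and §6 (with Thm 31, Thm 6, Thm 39, Prop 40(c))] -/
theorem heightDensityGE_rankZero_of_five_selmer_of_inputs
    (h31 : ∀ F : CongruenceFamily, F.IsLarge → ∀ ε : ℝ, 0 < ε → ∀ᶠ X : ℕ in atTop,
      heightAverageOn F.Mem (fun AB ↦ (Nat.card ((shortWeierstrass AB).selmerGroup 5) : ℝ)) X ≤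
        6 + ε)
    (h6 : ∃ (n : ℕ) (F : Fin n → CongruenceFamily), (∀ i, (F i).IsLarge) ∧
      (∀ i j, i ≠ j → ∀ AB, (F i).Mem AB → ¬ (F j).Mem AB) ∧
      (∀ AB, UnionMem F AB → UnionMem F (AB.1, -AB.2)) ∧
      (∀ AB, UnionMem F AB →
        (shortWeierstrass (AB.1, -AB.2)).rootNumber = -(shortWeierstrass AB).rootNumber) ∧
      HeightDensityGE (UnionMem F) 0.5501)
    (hDD : even_selmerRank_sub_torsionRank_iff) :
    HeightDensityGE (fun AB ↦ (shortWeierstrass AB).mordellWeilRank = 0) 0.2062 := by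
  have h := heightDensityGE_rankZero_of_five_selmer_family h31 h6 hDD
  intro ε hε
  filter_upwards [h ε hε] with X hX
  norm_num at hX ⊢
  linarith

/-- **Consequently the named fact `pos_proportion_rank_zero` of `BSDWave0.lean`** (a positive
proportion of elliptic curves over `ℚ` have rank `0`) follows from the three inputs of the `5`-Selmer
paper, with the proportion `20.62%` (the source, p. 2: "In [TC], we showed that a positive proportion
of elliptic curves have rank 0; however, the proportion that we demonstrated there was quite small").
A second conditional route to that fact, next to `pos_proportion_rank_zero_of_facts₃`
(`BSDRankZeroAssembly.lean`, the ternary-cubic-forms paper).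
[cite: BhargavaShankar5Selmer2013, Thm 5] -/
theorem pos_proportion_rank_zero_of_five_selmer_inputs
    (h31 : ∀ F : CongruenceFamily, F.IsLarge → ∀ ε : ℝ, 0 < ε → ∀ᶠ X : ℕ in atTop,
      heightAverageOn F.Mem (fun AB ↦ (Nat.card ((shortWeierstrass AB).selmerGroup 5) : ℝ)) X ≤
        6 + ε)
    (h6 : ∃ (n : ℕ) (F : Fin n → CongruenceFamily), (∀ i, (F i).IsLarge) ∧
      (∀ i j, i ≠ j → ∀ AB, (F i).Mem AB → ¬ (F j).Mem AB) ∧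
      (∀ AB, UnionMem F AB → UnionMem F (AB.1, -AB.2)) ∧
      (∀ AB, UnionMem F AB →
        (shortWeierstrass (AB.1, -AB.2)).rootNumber = -(shortWeierstrass AB).rootNumber) ∧
      HeightDensityGE (UnionMem F) 0.5501)
    (hDD : even_selmerRank_sub_torsionRank_iff) : pos_proportion_rank_zero :=
  ⟨0.2062, by norm_num, heightDensityGE_rankZero_of_five_selmer_of_inputs h31 h6 hDD⟩

end Reduction

/-! ### Prop 38(b) for the family of all curves: `19/24` from Theorem 1 alone -/

section NineteenTwentyFourths

/-- **Prop 38(b) on the family of all curves, granted Theorem 1 alone.** If the average of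
`#Sel^(5)(E_{A,B}/ℚ)` over the curves of naive height `< X` is eventually `≤ 6 + ε` for every
`ε > 0` (Theorem 1 of the source in `limsup` form, `HeightAverageLE (#Sel^(5)) 6`), then at least a
proportion `19/24 = 79.16%` of elliptic curves over `ℚ`, ordered by naive height, have Mordell–Weil
rank `≤ 1`: "`x_{0 or 1} + 25(1 - x_{0 or 1}) ≤ 6`, and hence `x_{0 or 1} ≥ 19/24`", with
`rank ≤ 5`-Selmer rank. No root numbers, parity theorem or large families enter (`card_two_le_rank_le`
with `U = ∅`). [cite: BhargavaShankar5Selmer2013, Prop 38(b) and §6 ("an upper bound for its rank")] -/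
theorem heightDensityGE_rankLeOne_nineteen_24ths_of_heightAverageLE_card_selmerFive
    (h1 : HeightAverageLE (fun AB ↦ (Nat.card ((shortWeierstrass AB).selmerGroup 5) : ℝ)) 6) :
    HeightDensityGE (fun AB ↦ (shortWeierstrass AB).mordellWeilRank ≤ 1) (19 / 24) := by
  intro ε hε
  filter_upwards [h1 (24 * ε) (by positivity), eventually_ge_atTop 28] with X hX1 hX28
  have hell : ∀ AB ∈ heightFamilyBelow X, (shortWeierstrass AB).IsElliptic :=
    fun AB hAB ↦ isElliptic_shortWeierstrass ((mem_heightFamilyBelow_iff AB X).mp hAB).1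
  have hpos : 0 < (heightFamilyBelow X).card :=
    Finset.card_pos.mpr ⟨_, zeroOne_mem_heightFamilyBelow hX28⟩
  have hN : (0 : ℝ) < (heightFamilyBelow X).card := by exact_mod_cast hpos
  unfold heightAverage at hX1
  rw [div_le_iff₀ hN] at hX1
  rw [heightProportion_eq_card_div, le_div_iff₀ hN]
  -- the count: `24·#{rank ≥ 2} ≤ ∑ #Sel^(5) - #{all}`
  have hcount : 24 * (((heightFamilyBelow X).filter
        (fun AB ↦ 2 ≤ (shortWeierstrass AB).mordellWeilRank)).card : ℝ) ≤
      ∑ AB ∈ heightFamilyBelow X, (Nat.card ((shortWeierstrass AB).selmerGroup 5) : ℝ) -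
        (heightFamilyBelow X).card := by
    rw [Finset.natCast_card_filter]
    have h := Finset.sum_le_sum (s := heightFamilyBelow X)
      (f := fun AB ↦ 24 * (if 2 ≤ (shortWeierstrass AB).mordellWeilRank then (1 : ℝ) else 0))
      (g := fun AB ↦ (Nat.card ((shortWeierstrass AB).selmerGroup 5) : ℝ) - 1) fun AB hAB ↦ by
        haveI := hell AB hAB
        exact twentyfour_mul_ite_two_le_rank_le (shortWeierstrass AB)
    rw [← Finset.mul_sum, Finset.sum_sub_distrib, Finset.sum_const, nsmul_eq_mul] at h
    linarith
  have hcompl : (((heightFamilyBelow X).filter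
        (fun AB ↦ (shortWeierstrass AB).mordellWeilRank ≤ 1)).card : ℝ) +
      ((heightFamilyBelow X).filter (fun AB ↦ 2 ≤ (shortWeierstrass AB).mordellWeilRank)).card =
      (heightFamilyBelow X).card := by
    have h := Finset.card_filter_add_card_filter_not (s := heightFamilyBelow X)
      (fun AB ↦ (shortWeierstrass AB).mordellWeilRank ≤ 1)
    have hcongr : (heightFamilyBelow X).filter
          (fun AB ↦ ¬ (shortWeierstrass AB).mordellWeilRank ≤ 1) =
        (heightFamilyBelow X).filter (fun AB ↦ 2 ≤ (shortWeierstrass AB).mordellWeilRank) :=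
      Finset.filter_congr fun AB _ ↦ ⟨fun h' ↦ by omega, fun h' ↦ by omega⟩
    rw [hcongr] at h
    exact_mod_cast h
  linarith [hcount, hcompl, hX1]

end NineteenTwentyFourths

end Literature.NumberTheory.EllipticCurves

end
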